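import Literature.Topology.Algebra.ProfiniteOutCongruence
import Literature.AnabelianGeometry.Anabelioids.OuterActionOfEquivalenceCongr
import HarnessLib

/-!
# The outer action of an automorphism of a connected anabelioid, in the profinite `Out`

[SemiAnbd] Def. 5.1 (i)(c) p. 62 ("the resulting outer homomorphism `H → Out(π̂₁(𝔾_v))` … relative to
the natural profinite group topology on `Out(π̂₁(𝔾_v))`") [cite: MochizukiSemiAnbd2006, Def 5.1 (i)(c) p.62].
`congrOutOfEquivalence F P : CongrOut (Aut F)` — the outer automorphism `outOfEquivalence F P` of
`OuterActionOfEquivalence.lean` placed in the PROFINITE `Out_top(π₁(X, F))` of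
`Literature/Topology/Algebra/ProfiniteOutCongruence.lean` (via `CongrOut.equivTopOut`), with `_eq_mk`,
`_id`, `_comp` and the 2-cell invariance `_congr`.  Mathlib-level plumbing; nothing disputed is involved.
-/

namespace Literature.AnabelianGeometry.Anabelioids

open CategoryTheory CategoryTheory.Functor CategoryTheory.PreGaloisCategory
open Literature.AnabelianGeometry.EtaleTheta (contMulAut mem_contMulAut TopOut)
open Literature.Topology.Algebra (CongrAut CongrOut)

universe u₁ u₂

variable {X : Type u₁} [Category.{u₂} X] [GaloisCategory X] (F : X ⥤ FintypeCat.{u₂}) [FiberFunctor F]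
  {P P' : X ⥤ X} [P.IsEquivalence] [P'.IsEquivalence]

/-! ## In the profinite `Out` -/

variable (P)

/-- **The outer automorphism of `π₁(X, F)` induced by `P`, in the profinite `Out_top(π₁(X, F)) =
CongrOut (Aut F)`** (transport of `outOfEquivalence F P` along `CongrOut.equivTopOut`).
[cite: MochizukiSemiAnbd2006, Def 5.1 (i)(c) p.62] -/
noncomputable def congrOutOfEquivalence : CongrOut (Aut F) :=
  (CongrOut.equivTopOut (G := Aut F)).symm (outOfEquivalence F P)

/-- `congrOutOfEquivalence` under `equivTopOut` is `outOfEquivalence`.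
[cite: MochizukiSemiAnbd2006, Def 5.1 (i)(c) p.62] -/
@[simp] theorem equivTopOut_congrOutOfEquivalence :
    CongrOut.equivTopOut (congrOutOfEquivalence F P) = outOfEquivalence F P :=
  MulEquiv.apply_symm_apply _ _

/-- `congrOutOfEquivalence` computed with any path `e : P ⋙ F ≅ F`.
[cite: MochizukiSemiAnbd2006, Def 5.1 (i)(c) p.62] -/
theorem congrOutOfEquivalence_eq_mk (e : P ⋙ F ≅ F) :
    congrOutOfEquivalence F P =
      CongrOut.mk (Aut F) ((CongrAut.equivContMulAut (Aut F)).symm (contAutOfPath F P e)) := by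
  apply (CongrOut.equivTopOut (G := Aut F)).injective
  rw [equivTopOut_congrOutOfEquivalence, outOfEquivalence_eq_mk F P e]
  rfl

omit [P.IsEquivalence] in
/-- `out(𝟭) = 1` in the profinite `Out`. [cite: MochizukiSemiAnbd2006, Def 5.1 (i)(c) p.62] -/
theorem congrOutOfEquivalence_id : congrOutOfEquivalence F (𝟭 X) = 1 := by
  rw [congrOutOfEquivalence, outOfEquivalence_id, map_one]

variable (P')

/-- `out(P ⋙ P') = out(P) · out(P')` in the profinite `Out` (pull-backs compose contravariantly to the
morphisms of anabelioids). [cite: MochizukiSemiAnbd2006, Def 5.1 (i)(c) p.62] -/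
theorem congrOutOfEquivalence_comp :
    congrOutOfEquivalence F (P ⋙ P') = congrOutOfEquivalence F P * congrOutOfEquivalence F P' := by
  rw [congrOutOfEquivalence, congrOutOfEquivalence, congrOutOfEquivalence, outOfEquivalence_comp, map_mul]

/-- 2-cell invariance in the profinite `Out`. [cite: MochizukiSemiAnbd2006, Def 5.1 (i)(c) p.62] -/
theorem congrOutOfEquivalence_congr (η : P ≅ P') :
    congrOutOfEquivalence F P = congrOutOfEquivalence F P' := by
  rw [congrOutOfEquivalence, congrOutOfEquivalence, outOfEquivalence_congr F P P' η]

end Literature.AnabelianGeometry.Anabelioids
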